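import Summits.AnomalousDissipation.AnomalousDissipation.Theorems.SawtoothPulseCascadeK1LocalisedCascadeNToothOutsideSharp

/-!
# K1loc explicit start — helper: SHARP OFF-LOBE ENERGY OF THE `N`-TOOTH CHIRP («NToothInsideSharp»)

Helper file of the prover lane on the crux `K1LocalisedCascade` (stmt-AnomalousDissipation-19491), route `SawtoothPulseCascade`
(arbiter A24-6 (1): table campaign, sharp off-tube constants).  Refines `NToothOffLobe` by keeping the factor `|m| + |λ|` and the
parity sparsity (`NToothParity`): for the exact `N`-tooth chirp with `λ = N·L`, `E ≥ 2`,
(outside counterpart in `NToothOutsideSharp`);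
* **`sum_inside_sq_norm_nTooth_sharp`**: `Σ_{|m| ≤ |λ|−NE} ‖ĝ₀(m)‖² ≤ 1/(π²(E−1)) + 2(|L|−E+1)/(π²|L|E)` (`E ≤ |L|`).
No definitions; nothing about the crux. [cite: Grafakos2014, Prop. 3.1.2 (5), Prop. 3.2.7 (3)] [problem: turb]
-/

-- `Summit.<Summit>.<Problem>`: single-conjunct summit, the duplicate namespace segment is deliberate.
set_option linter.dupNamespace false

noncomputable section

namespace Summit.AnomalousDissipation.AnomalousDissipation.Theorems.SawtoothPulseCascade.K1Window

open MeasureTheory Filter Topology UnitAddTorus Complex AddCircle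
open scoped Real
open Literature.Analysis Literature.Analysis.FunctionSpaces Literature.Analysis.FunctionSpaces.Torus Literature.Analysis.FluidPDE
open Literature.Analysis.FluidPDE.ShearStage Literature.Analysis.FluidPDE.SawtoothCascade
open Summit.AnomalousDissipation.AnomalousDissipation.Theorems.SawtoothPulseCascade.K1Start

/-! ## §3 Inside the lobes, sharp -/

/-- **Energy strictly inside, sharp**: for `λ = N·L`, `2 ≤ E ≤ |L|`,
`Σ_{|m| ≤ |λ|−NE} ‖ĝ₀(m)‖² ≤ 1/(π²(E−1)) + 2(|L|−E+1)/(π²|L|E)`. [cite: Grafakos2014, Prop. 3.1.2 (5)] -/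
theorem sum_inside_sq_norm_nTooth_sharp {N : ℕ} (hN : 0 < N) {lam L : ℤ} (hL : lam = N * L) {g₀ : UnitAddCircle → ℂ}
    (hg₀ : ∀ t : ℝ, g₀ (t : UnitAddCircle) = Complex.exp (-(2 * π * I * lam * ((tri (2 * π * N * t) / (2 * π * N) : ℝ) : ℂ))))
    {E : ℕ} (hE : 2 ≤ E) (hEL : (E : ℤ) ≤ |L|) :
    ∑ m ∈ Finset.Icc (-(|lam| - (N : ℤ) * E)) (|lam| - (N : ℤ) * E), ‖fourierCoeff g₀ m‖ ^ 2 ≤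
      1 / (π ^ 2 * ((E : ℝ) - 1)) + 2 * (|(L : ℝ)| - E + 1) / (π ^ 2 * (|(L : ℝ)| * E)) := by
  classical
  have hπ : 0 < π := Real.pi_pos
  have hNz : (0 : ℤ) < N := by exact_mod_cast hN
  have hE' : (2 : ℝ) ≤ E := by exact_mod_cast hE
  have hlam : |lam| = (N : ℤ) * |L| := by rw [hL, abs_mul, Nat.abs_cast]
  have hLr : ((|L| : ℤ) : ℝ) = |(L : ℝ)| := by push_cast; rfl
  have hEL' : (E : ℝ) ≤ |(L : ℝ)| := by
    have : ((E : ℤ) : ℝ) ≤ ((|L| : ℤ) : ℝ) := by exact_mod_cast hEL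
    push_cast at this; exact this
  have hL0 : 0 < |(L : ℝ)| := by linarith
  set K : ℤ := |L| - E with hK
  have hK0 : 0 ≤ K := by rw [hK]; linarith
  set M : ℤ := |lam| - (N : ℤ) * E with hM
  have hMN : M = (N : ℤ) * K := by rw [hM, hlam, hK]; ring
  -- reduce to the multiples `m = Nj`, `|j| ≤ K`
  set S : Finset ℤ := (Finset.Icc (-K) K).image (fun j => (N : ℤ) * j) with hS
  have hSsub : S ⊆ Finset.Icc (-M) M := by
    intro m hm
    rw [hS, Finset.mem_image] at hm
    obtain ⟨j, hj, rfl⟩ := hm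
    rw [Finset.mem_Icc] at hj ⊢
    rw [hMN]; constructor <;> nlinarith
  have hzero : ∀ m ∈ Finset.Icc (-M) M, m ∉ S → ‖fourierCoeff g₀ m‖ ^ 2 = 0 := by
    intro m hm hmS
    rw [Finset.mem_Icc] at hm
    have hd : ¬ (N : ℤ) ∣ m := by
      rintro ⟨j, rfl⟩
      apply hmS
      rw [hS, Finset.mem_image]
      refine ⟨j, Finset.mem_Icc.2 ⟨?_, ?_⟩, rfl⟩ <;> nlinarith
    have hm' : |m| ≠ |lam| := by
      have : (1 : ℤ) ≤ (N : ℤ) * E := by nlinarith [show (2 : ℤ) ≤ E by exact_mod_cast hE]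
      have : |m| ≤ M := abs_le.2 hm
      omega
    simp [fourierCoeff_nTooth_eq_zero_of_not_dvd hN lam hg₀ hm' hd]
  rw [← Finset.sum_subset hSsub (fun m hm hmS => hzero m hm hmS), hS,
    Finset.sum_image fun a _ b _ h => mul_left_cancel₀ hNz.ne' h]
  -- termwise: parity and the exact square of the partial fractions
  set x : ℤ → ℝ := fun j => 1 / (|(L : ℝ)| - j) with hx
  have hterm : ∀ j ∈ Finset.Icc (-K) K, ‖fourierCoeff g₀ ((N : ℤ) * j)‖ ^ 2 ≤
      (if Even (L + j) then 0 else 1) * (1 / π ^ 2 * (x j ^ 2 + x (-j) ^ 2 + 1 / |(L : ℝ)| * (x j + x (-j)))) := by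
    intro j hj
    rw [Finset.mem_Icc] at hj
    have hjr : -((|(L : ℝ)|) - E) ≤ (j : ℝ) ∧ (j : ℝ) ≤ |(L : ℝ)| - E := by
      constructor
      · have : ((-K : ℤ) : ℝ) ≤ (j : ℝ) := by exact_mod_cast hj.1
        rw [hK] at this; push_cast at this; linarith
      · have : (j : ℝ) ≤ ((K : ℤ) : ℝ) := by exact_mod_cast hj.2
        rw [hK] at this; push_cast at this; linarith
    have ha : 0 < |(L : ℝ)| - j := by linarith
    have hb : 0 < |(L : ℝ)| + j := by linarith
    have hjL : |j| ≠ |L| := by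
      have : |j| ≤ K := abs_le.2 hj
      rw [hK] at this; have : (1 : ℤ) ≤ E := by linarith
      omega
    have h := norm_fourierCoeff_nTooth_mul_le hN hL hg₀ hjL
    by_cases hev : Even (L + j)
    · rw [if_pos hev] at h
      rw [if_pos hev, zero_mul]
      have : ‖fourierCoeff g₀ ((N : ℤ) * j)‖ = 0 := le_antisymm h (norm_nonneg _)
      rw [this]; norm_num
    · rw [if_neg hev] at h
      rw [if_neg hev, one_mul]
      have hfac : |((L : ℝ)) ^ 2 - (j : ℝ) ^ 2| = (|(L : ℝ)| - j) * (|(L : ℝ)| + j) := by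
        rw [← sq_abs (L : ℝ), abs_of_pos (by nlinarith)]; ring
      rw [hfac] at h
      have e : 2 * |(L : ℝ)| / (π * ((|(L : ℝ)| - j) * (|(L : ℝ)| + j))) = 1 / π * (x j + x (-j)) := by
        simp only [hx]; push_cast
        rw [show |(L : ℝ)| - -(j : ℝ) = |(L : ℝ)| + j by ring]
        field_simp
        ring
      rw [e] at h
      have hsq := pow_le_pow_left₀ (norm_nonneg _) h 2
      refine hsq.trans (le_of_eq ?_)
      have hcross : x j * x (-j) = 1 / (2 * |(L : ℝ)|) * (x j + x (-j)) := by
        simp only [hx]; push_cast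
        rw [show |(L : ℝ)| - -(j : ℝ) = |(L : ℝ)| + j by ring]
        field_simp
        ring
      have : (1 / π * (x j + x (-j))) ^ 2 = 1 / π ^ 2 * (x j ^ 2 + x (-j) ^ 2 + 2 * (x j * x (-j))) := by ring
      rw [this, hcross]
      ring
  refine (Finset.sum_le_sum hterm).trans ?_
  set P : ℤ → ℝ := fun j => if Even (L + j) then 0 else 1 with hP
  have hP0 : ∀ j, 0 ≤ P j := fun j => by simp only [hP]; split_ifs <;> norm_num
  have hPsym : ∀ j, P (-j) = P j := by
    intro j; simp only [hP]
    have : Even (L + -j) ↔ Even (L + j) := by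
      rw [show L + -j = (L + j) - 2 * j by ring, Int.even_sub]
      exact ⟨fun h => h.2 (even_two_mul _), fun h => ⟨fun _ => even_two_mul _, fun _ => h⟩⟩
    simp only [this]
  have hIcc_sym : ∀ f : ℤ → ℝ, ∑ j ∈ Finset.Icc (-K) K, f (-j) = ∑ j ∈ Finset.Icc (-K) K, f j := by
    intro f
    refine Finset.sum_equiv (Equiv.neg ℤ) (fun j => ?_) (fun j _ => ?_)
    · simp only [Equiv.neg_apply, Finset.mem_Icc]; omega
    · simp only [Equiv.neg_apply]
  -- linearise
  have hlin : ∑ j ∈ Finset.Icc (-K) K, P j * (1 / π ^ 2 * (x j ^ 2 + x (-j) ^ 2 + 1 / |(L : ℝ)| * (x j + x (-j)))) =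
      1 / π ^ 2 * (∑ j ∈ Finset.Icc (-K) K, P j * x j ^ 2 + ∑ j ∈ Finset.Icc (-K) K, P j * x (-j) ^ 2) +
      1 / (π ^ 2 * |(L : ℝ)|) * (∑ j ∈ Finset.Icc (-K) K, P j * x j + ∑ j ∈ Finset.Icc (-K) K, P j * x (-j)) := by
    rw [← Finset.sum_add_distrib, ← Finset.sum_add_distrib, Finset.mul_sum, Finset.mul_sum, ← Finset.sum_add_distrib]
    refine Finset.sum_congr rfl fun j _ => ?_
    ring
  have e1 : ∑ j ∈ Finset.Icc (-K) K, P j * x (-j) ^ 2 = ∑ j ∈ Finset.Icc (-K) K, P j * x j ^ 2 := by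
    have h := hIcc_sym (fun j => P j * x j ^ 2)
    simp only [hPsym] at h
    exact h
  have e2 : ∑ j ∈ Finset.Icc (-K) K, P j * x (-j) = ∑ j ∈ Finset.Icc (-K) K, P j * x j := by
    have h := hIcc_sym (fun j => P j * x j)
    simp only [hPsym] at h
    exact h
  rw [hlin, e1, e2]
  -- the class representative `i₀ ∈ {E, E+1}` with `L + |L| + i₀` odd, and the progression `j = |L| − i₀ − 2t`
  set i₀ : ℤ := if (L + |L| + E) % 2 = 0 then (E : ℤ) + 1 else E with hi₀
  have hi₀E : (E : ℤ) ≤ i₀ ∧ i₀ ≤ E + 1 := by simp only [hi₀]; split_ifs <;> omega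
  have hi₀par : (L + |L| + i₀) % 2 = 1 := by simp only [hi₀]; split_ifs with h <;> omega
  set Sf : Finset ℤ := (Finset.Icc (-K) K).filter (fun j => ¬ Even (L + j)) with hSf
  have hPf : ∀ f : ℤ → ℝ, ∑ j ∈ Finset.Icc (-K) K, P j * f j = ∑ j ∈ Sf, f j := by
    intro f
    rw [hSf, Finset.sum_filter]
    refine Finset.sum_congr rfl fun j _ => ?_
    simp only [hP]
    split_ifs <;> simp
  set img : Finset ℤ := (Finset.range (K.toNat + 1)).image (fun t : ℕ => |L| - i₀ - 2 * (t : ℤ)) with himg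
  have hsub : Sf ⊆ img := by
    intro j hj
    rw [hSf, Finset.mem_filter, Finset.mem_Icc, Int.even_iff] at hj
    rw [himg, Finset.mem_image]
    refine ⟨((|L| - i₀ - j) / 2).toNat, ?_, ?_⟩
    · rw [Finset.mem_range]
      have : ((|L| - i₀ - j) / 2).toNat < K.toNat + 1 := by omega
      exact this
    · omega
  have hinj : Set.InjOn (fun t : ℕ => |L| - i₀ - 2 * (t : ℤ)) ↑(Finset.range (K.toNat + 1)) := fun a _ b _ h => by
    simp only at h; omega
  have hxt : ∀ t : ℕ, x (|L| - i₀ - 2 * (t : ℤ)) = 1 / ((i₀ : ℝ) + 2 * t) := by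
    intro t; simp only [hx]; push_cast; rw [← hLr]; ring_nf
  have hi₀2 : (2 : ℤ) ≤ i₀ := by omega
  have hi₀r : (2 : ℝ) ≤ (i₀ : ℝ) := by exact_mod_cast hi₀2
  have hKr : ((K.toNat : ℕ) : ℝ) = |(L : ℝ)| - E := by
    rw [← hLr]; have : ((K.toNat : ℕ) : ℤ) = K := Int.toNat_of_nonneg hK0
    have h2 := congrArg (fun z : ℤ => (z : ℝ)) this
    push_cast at h2; rw [h2, hK]; push_cast; ring
  -- `Σ P x² ≤ 1/(2(E−1))`
  have hT1 : ∑ j ∈ Finset.Icc (-K) K, P j * x j ^ 2 ≤ 1 / (2 * ((E : ℝ) - 1)) := by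
    rw [hPf]
    calc ∑ j ∈ Sf, x j ^ 2 ≤ ∑ j ∈ img, x j ^ 2 := Finset.sum_le_sum_of_subset_of_nonneg hsub fun _ _ _ => sq_nonneg _
      _ = ∑ t ∈ Finset.range (K.toNat + 1), 1 / (((i₀ : ℝ) + 2 * t) ^ 2) := by
          rw [himg, Finset.sum_image hinj]
          exact Finset.sum_congr rfl fun t _ => by rw [hxt, one_div_pow]
      _ ≤ 1 / (2 * ((i₀ : ℝ) - 1)) - 1 / (2 * ((i₀ : ℝ) + 2 * ((K.toNat + 1 : ℕ) : ℝ) - 1)) :=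
          sum_range_inv_sq_step2_le hi₀r _
      _ ≤ 1 / (2 * ((E : ℝ) - 1)) := by
          have h1 : 0 ≤ 1 / (2 * ((i₀ : ℝ) + 2 * ((K.toNat + 1 : ℕ) : ℝ) - 1)) := by
            have : (0 : ℝ) ≤ ((K.toNat + 1 : ℕ) : ℝ) := Nat.cast_nonneg _
            exact one_div_nonneg.2 (by linarith)
          have h2 : 1 / (2 * ((i₀ : ℝ) - 1)) ≤ 1 / (2 * ((E : ℝ) - 1)) := by
            have : (E : ℝ) ≤ i₀ := by exact_mod_cast hi₀E.1
            exact one_div_le_one_div_of_le (by linarith) (by linarith)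
          linarith
  -- `Σ P x ≤ (|L|−E+1)/E`
  have hT3 : ∑ j ∈ Finset.Icc (-K) K, P j * x j ≤ (|(L : ℝ)| - E + 1) / E := by
    rw [hPf]
    have hE0 : (0 : ℝ) < E := by linarith
    calc ∑ j ∈ Sf, x j ≤ ∑ j ∈ img, x j := Finset.sum_le_sum_of_subset_of_nonneg hsub fun j hj _ => by
            rw [himg, Finset.mem_image] at hj
            obtain ⟨t, _, rfl⟩ := hj
            rw [hxt]; positivity
      _ = ∑ t ∈ Finset.range (K.toNat + 1), 1 / ((i₀ : ℝ) + 2 * t) := by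
          rw [himg, Finset.sum_image hinj]
          exact Finset.sum_congr rfl fun t _ => hxt t
      _ ≤ ∑ t ∈ Finset.range (K.toNat + 1), 1 / (E : ℝ) := Finset.sum_le_sum fun t _ => by
            have : (E : ℝ) ≤ i₀ := by exact_mod_cast hi₀E.1
            have ht : (0 : ℝ) ≤ t := Nat.cast_nonneg _
            exact one_div_le_one_div_of_le hE0 (by linarith)
      _ = (|(L : ℝ)| - E + 1) / E := by
          rw [Finset.sum_const, Finset.card_range, nsmul_eq_mul]; push_cast; rw [hKr]; ring
  have hπ2 : 0 < π ^ 2 := by positivity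
  calc 1 / π ^ 2 * (∑ j ∈ Finset.Icc (-K) K, P j * x j ^ 2 + ∑ j ∈ Finset.Icc (-K) K, P j * x j ^ 2) +
        1 / (π ^ 2 * |(L : ℝ)|) * (∑ j ∈ Finset.Icc (-K) K, P j * x j + ∑ j ∈ Finset.Icc (-K) K, P j * x j)
      ≤ 1 / π ^ 2 * (1 / (2 * ((E : ℝ) - 1)) + 1 / (2 * ((E : ℝ) - 1))) +
        1 / (π ^ 2 * |(L : ℝ)|) * ((|(L : ℝ)| - E + 1) / E + (|(L : ℝ)| - E + 1) / E) :=
          add_le_add (mul_le_mul_of_nonneg_left (add_le_add hT1 hT1) (by positivity))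
            (mul_le_mul_of_nonneg_left (add_le_add hT3 hT3) (by positivity))
    _ = 1 / (π ^ 2 * ((E : ℝ) - 1)) + 2 * (|(L : ℝ)| - E + 1) / (π ^ 2 * (|(L : ℝ)| * E)) := by
          have h4 : 0 < (E : ℝ) - 1 := by linarith
          field_simp
          ring

end Summit.AnomalousDissipation.AnomalousDissipation.Theorems.SawtoothPulseCascade.K1Window
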